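import Mathlib
import Summits.MatrixMultiplication.Statement
import Literature.Computability.AlgebraicComplexity.FlatteningBound
import Literature.Computability.AlgebraicComplexity.NonscalarComputation
import Literature.Computability.AlgebraicComplexity.NonscalarBilinearRank
import Summits.MatrixMultiplication.MatrixMultiplication.Theorems.GraphEquationsSystems
import Summits.MatrixMultiplication.MatrixMultiplication.Theorems.GraphEquationsKernel

/-!
# The cost–rank inequality for reduced systems, down to one coefficient identity (`GraphEquations`, 4/4)

Decomp-mm node `N5²³` «GraphEquations», the ATTACKABLE leaf `H_red♭` (cost version
`ReducedSystemsCostRankCost`: a correct equation system for `W_n`, reduced at some point of the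
graph, has `cost ≥ R(⟨n,n,n⟩)/2`), hence `H_red = ReducedEquationsForceMultiplication`, is reduced
here — kernel-checked — to ONE named commutative-algebra statement `CoeffIdentity`
(for a polynomial `t` vanishing on the graph, `coeff_{a_ij b_j'l}(t) = −[j = j'] · coeff_{c_il}(t)`;
proof on paper: `t(A, B, AB) ≡ 0`, compare the coefficient of `a_ij b_j'l` — only the monomials
`a_ij b_j'l` and `c_il` of `t` can produce it under `c ↦ AB`, by degree count).

Pipeline (all in the tree): `ArithCircuit.exists_isNonscalarSeq_gateValues` (the tests lie in the
cost-free span of ONE nonscalar sequence of length `≤ cost`, BCS (4.7)) →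
`IsNonscalarSeq.aeval_append` with `hs = []` (substitution of AFFINE-LINEAR forms is free,
BCS §4.1 Rem. (4.3): this moves the reduced point `x = (A₀, B₀, A₀B₀)` to the origin WITHOUT
changing the length — the `W_n`-automorphism `(A,B,C) ↦ (A₀+A, B₀+B, A₀B₀+C+A₀B+AB₀)`, `shift`) →
`exists_triads_of_isNonscalarSeq` (BCS Prop. (14.1)/(14.8): the `A ⊗ B`-bilinear coefficients of
the tests form a tensor of rank `≤ 2 · cost`) → `CoeffIdentity` (that tensor is
`−(id ⊗ id ⊗ J_C(x)) ⟨n,n,n⟩`) → a left inverse of the full-rank `J_C(x)`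
(`leftInverse_of_rank_eq`, rank–nullity) → `tensorRank_le_of_eq_sum`.

Main results (no `sorry`; `CoeffIdentity` enters as a hypothesis):
* `tensorRank_le_of_vanishing` — SYSTEM-FREE core: polynomials vanishing on `W_n`, lying in the
  span of one nonscalar sequence of length `≤ N`, with full-rank linear `C`-coefficient matrix,
  force `R(⟨n,n,n⟩) ≤ 2N`.
* `costRankZero_of_coeffIdentity : CoeffIdentity → ReducedSystemsCostRankZero` (reduced at `0`).
* `costRankCost_of_coeffIdentity : CoeffIdentity → ReducedSystemsCostRankCost` (reduced anywhere
  on the graph; via `shift`, `pderiv_inr_bind₁_shift`, `coeff_inr_bind₁_shift`).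
* `reducedForce_of_coeffIdentity : CoeffIdentity → H_red` and
  `matrixMultiplication_of_coeffIdentity : V → CoeffIdentity → H_mult → S`.

Design note (decomp-mm critic, STATUS l.1216, binding): the transport is done at the level of
POLYNOMIALS / nonscalar sequences, where affine substitution is free — NOT by transporting the
circuit (which would cost `≈ 2n³` extra gates); no `OriginTransport` statement exists.

Sources: [BurgisserClausenShokrollahi1997, §4.1 Rem. (4.3), (4.7), Prop. (14.1), (14.8), §15.1,
Problem 16.3]; [Strassen1973 Vermeidung von Divisionen].
-/

set_option linter.dupNamespace false

noncomputable section

open scoped BigOperators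

namespace Summit.MatrixMultiplication.MatrixMultiplication.Theorems.GraphEquations

open Literature.Computability.AlgebraicComplexity
open Literature.Computability.AlgebraicComplexity.ArithCircuit

/-! ## Statements -/

/-- `H_red♭₀`: the cost–rank inequality for correct systems reduced AT THE ORIGIN. -/
def ReducedSystemsCostRankZero : Prop :=
  ∀ (n : ℕ) (E : EqSystem n), E.Correct → E.ReducedAt 0 →
    tensorRank (matMulTensor ℂ n n n) ≤ 2 * E.cost

/-- **`CoeffIdentity` (named statement; commutative algebra, S-sized, the ONE stub of the reduced
branch).** For a polynomial `t ∈ ℂ[A,B,C]` vanishing on the graph `W_n` and all `i j j' l`: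
`coeff_{a_ij b_j'l}(t) = −[j = j'] · coeff_{c_il}(t)`.  (Proof on paper: `t(A,B,AB) = 0` in
`ℂ[A,B]`; under `c_pq ↦ Σ_k a_pk b_kq` a monomial of `t` of `C`-degree `d_c` becomes homogeneous
of degree `d_a + d_b + 2 d_c`, so only the monomials `a_ij b_j'l` and `c_il` reach `a_ij b_j'l`.) -/
def CoeffIdentity : Prop :=
  ∀ (n : ℕ) (t : MvPolynomial (GraphVars n) ℂ), (∀ x ∈ mmGraph n, MvPolynomial.eval x t = 0) →
    ∀ i j j' l : Fin n,
      MvPolynomial.coeff (Finsupp.single (Sum.inl (Sum.inl (i, j)) : GraphVars n) 1 +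
          Finsupp.single (Sum.inl (Sum.inr (j', l)) : GraphVars n) 1) t =
        -(if j = j' then
            MvPolynomial.coeff (Finsupp.single (Sum.inr (i, l) : GraphVars n) 1) t else 0)

/-- The matrix of LINEAR `C`-coefficients of a family of polynomials. -/
def linCoeffC {n T : ℕ} (p : Fin T → MvPolynomial (GraphVars n) ℂ) :
    Matrix (Fin T) (Fin n × Fin n) ℂ :=
  Matrix.of fun o q => MvPolynomial.coeff (Finsupp.single (Sum.inr q : GraphVars n) 1) (p o)

/-! ## Linear algebra: full column rank ⇒ left inverse -/

/-- A matrix of full column rank has a left inverse (rank–nullity). -/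
theorem leftInverse_of_rank_eq {T n : ℕ} (J : Matrix (Fin T) (Fin n × Fin n) ℂ)
    (hJ : J.rank = n * n) : ∃ P : Matrix (Fin n × Fin n) (Fin T) ℂ, P * J = 1 := by
  classical
  have hker : LinearMap.ker (Matrix.toLin' J) = ⊥ := by
    have h1 := LinearMap.finrank_range_add_finrank_ker (Matrix.toLin' J)
    have h2 : Module.finrank ℂ (LinearMap.range (Matrix.toLin' J)) = n * n := by
      rw [Matrix.toLin'_apply']; exact hJ
    have h3 : Module.finrank ℂ ((Fin n × Fin n) → ℂ) = n * n := by simp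
    have h4 : Module.finrank ℂ (LinearMap.ker (Matrix.toLin' J)) = 0 := by omega
    exact Submodule.finrank_eq_zero.mp h4
  obtain ⟨g, hg⟩ := LinearMap.exists_leftInverse_of_injective (Matrix.toLin' J) hker
  refine ⟨LinearMap.toMatrix' g, ?_⟩
  have := congrArg LinearMap.toMatrix' hg
  rwa [LinearMap.toMatrix'_comp, LinearMap.toMatrix'_toLin', LinearMap.toMatrix'_id] at this

/-! ## The system-free core -/

/-- **System-free core.** If `T` polynomials vanish on `W_n`, lie in the cost-free span of one
nonscalar sequence of length `≤ N`, and their linear `C`-coefficient matrix has rank `n²`, then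
`R(⟨n,n,n⟩) ≤ 2N` — given `CoeffIdentity`. -/
theorem tensorRank_le_of_vanishing (hC : CoeffIdentity) {n T N : ℕ}
    (p : Fin T → MvPolynomial (GraphVars n) ℂ)
    (hvan : ∀ o, ∀ x ∈ mmGraph n, MvPolynomial.eval x (p o) = 0)
    (hspan : ∃ gs : List (MvPolynomial (GraphVars n) ℂ), IsNonscalarSeq gs ∧ gs.length ≤ N ∧
      ∀ o, p o ∈ freeSpan {q | q ∈ gs})
    (hrank : (linCoeffC p).rank = n * n) :
    tensorRank (matMulTensor ℂ n n n) ≤ 2 * N := by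
  classical
  obtain ⟨r, hr, w, u, v, hwuv⟩ := exists_triads_of_isNonscalarSeq
    (fun a : Fin n × Fin n => (Sum.inl (Sum.inl a) : GraphVars n))
    (fun b : Fin n × Fin n => (Sum.inl (Sum.inr b) : GraphVars n))
    (fun a b h => by simp at h) p hspan
  obtain ⟨P, hPJ⟩ := leftInverse_of_rank_eq (linCoeffC p) hrank
  refine le_trans (tensorRank_le_of_eq_sum (fun ρ c => -∑ o, P c o * w ρ o) u v ?_) hr
  funext c a b
  obtain ⟨i, j⟩ := a
  obtain ⟨j', l⟩ := b
  have key : ∀ o, ∑ ρ, w ρ o * u ρ (i, j) * v ρ (j', l) =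
      -(if j = j' then linCoeffC p o (i, l) else 0) := by
    intro o; rw [hwuv]; exact hC n (p o) (hvan o) i j j' l
  have hPJ' : ∀ q, ∑ o, P c o * linCoeffC p o q = if c = q then 1 else 0 := by
    intro q
    have := congrFun (congrFun hPJ c) q
    simpa [Matrix.mul_apply, Matrix.one_apply] using this
  have hsum : ∑ ρ, (-∑ o, P c o * w ρ o) * u ρ (i, j) * v ρ (j', l) =
      -∑ o, P c o * ∑ ρ, w ρ o * u ρ (i, j) * v ρ (j', l) := by
    simp only [neg_mul, Finset.sum_neg_distrib, Finset.sum_mul, Finset.mul_sum]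
    rw [Finset.sum_comm]
    congr 1
    refine Finset.sum_congr rfl fun o _ => Finset.sum_congr rfl fun ρ _ => by ring
  simp only [Finset.sum_apply, triad_apply]
  rw [hsum]
  simp_rw [key]
  by_cases hjj : j = j'
  · subst hjj
    simp only [if_true, mul_neg, Finset.sum_neg_distrib, neg_neg, hPJ']
    obtain ⟨c1, c2⟩ := c
    simp [matMulTensor, Prod.ext_iff]
  · simp [matMulTensor, hjj]

/-! ## `H_red♭₀`: systems reduced at the origin -/

/-- The `C`-Jacobian at the origin is the linear `C`-coefficient matrix of the tests. -/
theorem jacobianC_zero_eq_linCoeffC {n : ℕ} (E : EqSystem n) :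
    E.jacobianC 0 = linCoeffC fun o => E.testPoly (E.tests.get o) := by
  ext s q
  rw [EqSystem.jacobianC_zero_apply]
  rfl

/-- The tests of a fan-in-two system lie in the cost-free span of one nonscalar sequence of
length `≤ cost` (BCS (4.7), tree). -/
theorem exists_isNonscalarSeq_tests {n : ℕ} (E : EqSystem n) (hE : E.circuit.IsFanInTwo) :
    ∃ gs : List (MvPolynomial (GraphVars n) ℂ), IsNonscalarSeq gs ∧ gs.length ≤ E.cost ∧
      ∀ o : Fin E.tests.length, E.testPoly (E.tests.get o) ∈ freeSpan {q | q ∈ gs} := by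
  obtain ⟨gs, hns, hlen, hvals⟩ := ArithCircuit.exists_isNonscalarSeq_gateValues E.circuit.gates hE
  refine ⟨gs, hns, hlen, fun o => ?_⟩
  simp only [EqSystem.testPoly, List.getD_eq_getElem?_getD]
  cases h : (gateValues E.circuit.gates)[E.tests.get o]? with
  | none => simp
  | some q => simpa using hvals q (List.mem_of_getElem? h)

/-- **`CoeffIdentity → H_red♭₀`.** -/
theorem costRankZero_of_coeffIdentity (hC : CoeffIdentity) : ReducedSystemsCostRankZero := by
  intro n E hE h0
  refine tensorRank_le_of_vanishing hC (fun o => E.testPoly (E.tests.get o))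
    (fun o x hx => hE.eval_testPoly_eq_zero hx (List.get_mem _ _))
    (exists_isNonscalarSeq_tests E hE.1) ?_
  rw [← jacobianC_zero_eq_linCoeffC]; exact h0

/-! ## Moving a reduced point of the graph to the origin, for free -/

section Shift

variable {n : ℕ}

/-- The affine substitution `θ_x` realising the `W_n`-automorphism
`(A,B,C) ↦ (A₀+A, B₀+B, C₀+C+A₀B+AB₀)` for `x = (A₀,B₀,C₀)`: every coordinate goes to an
AFFINE-LINEAR form. -/
def shift (x : GraphVars n → ℂ) : GraphVars n → MvPolynomial (GraphVars n) ℂ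
  | Sum.inl v => MvPolynomial.X (Sum.inl v) + MvPolynomial.C (x (Sum.inl v))
  | Sum.inr (i, l) => MvPolynomial.X (Sum.inr (i, l)) + MvPolynomial.C (x (Sum.inr (i, l))) +
      ∑ j : Fin n, (x (Sum.inl (Sum.inl (i, j))) • MvPolynomial.X (Sum.inl (Sum.inr (j, l))) +
        x (Sum.inl (Sum.inr (j, l))) • MvPolynomial.X (Sum.inl (Sum.inl (i, j))))

/-- The point `θ_x(y)`. -/
def shiftPoint (x y : GraphVars n → ℂ) : GraphVars n → ℂ :=
  fun v => MvPolynomial.eval y (shift x v)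

/-- Affine-linear forms are cost-free given NOTHING. -/
theorem shift_mem_freeSpan (x : GraphVars n → ℂ) (v : GraphVars n) :
    shift x v ∈ freeSpan {q | q ∈ ([] : List (MvPolynomial (GraphVars n) ℂ))} := by
  rcases v with v | ⟨i, l⟩
  · exact Submodule.add_mem _ (X_mem_freeSpan _ _) (C_mem_freeSpan _ _)
  · refine Submodule.add_mem _ (Submodule.add_mem _ (X_mem_freeSpan _ _) (C_mem_freeSpan _ _)) ?_
    refine Submodule.sum_mem _ fun j _ => Submodule.add_mem _ ?_ ?_
    · exact Submodule.smul_mem _ _ (X_mem_freeSpan _ _)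
    · exact Submodule.smul_mem _ _ (X_mem_freeSpan _ _)

/-- Evaluating a substituted polynomial = evaluating at the shifted point. -/
theorem eval_bind₁_shift (x y : GraphVars n → ℂ) (t : MvPolynomial (GraphVars n) ℂ) :
    MvPolynomial.eval y (MvPolynomial.bind₁ (shift x) t) = MvPolynomial.eval (shiftPoint x y) t :=
  MvPolynomial.eval₂Hom_bind₁ _ _ _ _

/-- `θ_x(0) = x`. -/
theorem shiftPoint_zero (x : GraphVars n → ℂ) : shiftPoint x 0 = x := by
  funext v
  rcases v with v | ⟨i, l⟩ <;> simp [shiftPoint, shift]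

/-- `θ_x` maps the graph into the graph when `x` is on the graph:
`(A₀+A)(B₀+B) = A₀B₀ + AB + A₀B + AB₀`. -/
theorem shiftPoint_mem_mmGraph {x y : GraphVars n → ℂ} (hx : x ∈ mmGraph n) (hy : y ∈ mmGraph n) :
    shiftPoint x y ∈ mmGraph n := by
  intro i l
  simp only [shiftPoint, shift, map_add, map_sum, MvPolynomial.eval_X, MvPolynomial.eval_C,
    MvPolynomial.smul_eval]
  rw [hy i l, hx i l, ← Finset.sum_add_distrib, ← Finset.sum_add_distrib]
  refine Finset.sum_congr rfl fun j _ => ?_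
  ring

/-- A substituted test still vanishes on the graph. -/
theorem eval_bind₁_shift_eq_zero {x : GraphVars n → ℂ} (hx : x ∈ mmGraph n)
    {t : MvPolynomial (GraphVars n) ℂ} (ht : ∀ y ∈ mmGraph n, MvPolynomial.eval y t = 0)
    {y : GraphVars n → ℂ} (hy : y ∈ mmGraph n) :
    MvPolynomial.eval y (MvPolynomial.bind₁ (shift x) t) = 0 := by
  rw [eval_bind₁_shift]; exact ht _ (shiftPoint_mem_mmGraph hx hy)

/-- `∂θ_x(v)/∂c_q = [v = c_q]`: the `C`-coordinates are shifted, never mixed. -/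
theorem pderiv_inr_shift (x : GraphVars n → ℂ) (q : Fin n × Fin n) (v : GraphVars n) :
    MvPolynomial.pderiv (Sum.inr q) (shift x v) =
      if v = Sum.inr q then 1 else 0 := by
  classical
  rcases v with v | ⟨i, l⟩
  · simp [shift, MvPolynomial.pderiv_X]
  · simp only [shift, map_add, map_sum, MvPolynomial.pderiv_C, add_zero, Derivation.map_smul,
      MvPolynomial.pderiv_X, Pi.single_apply, Sum.inr.injEq]
    simp [eq_comm]

/-- **Chain rule for the shift**: `∂/∂c_q` commutes with the substitution `θ_x`. -/
theorem pderiv_inr_bind₁_shift (x : GraphVars n → ℂ) (q : Fin n × Fin n)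
    (t : MvPolynomial (GraphVars n) ℂ) :
    MvPolynomial.pderiv (Sum.inr q) (MvPolynomial.bind₁ (shift x) t) =
      MvPolynomial.bind₁ (shift x) (MvPolynomial.pderiv (Sum.inr q) t) := by
  classical
  induction t using MvPolynomial.induction_on with
  | C a => simp
  | add p q' hp hq => simp [hp, hq]
  | mul_X p v h =>
    rw [map_mul, MvPolynomial.bind₁_X_right, MvPolynomial.pderiv_mul, h, MvPolynomial.pderiv_mul,
      map_add, map_mul, map_mul, MvPolynomial.bind₁_X_right, pderiv_inr_shift,
      MvPolynomial.pderiv_X]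
    congr 2
    simp only [Pi.single_apply]
    split_ifs <;> simp

/-- **Linear `C`-coefficients after the shift are the `C`-derivatives at `x`**:
`coeff_{c_q}(θ_x^* t) = (∂t/∂c_q)(x)`. -/
theorem coeff_inr_bind₁_shift (x : GraphVars n → ℂ) (q : Fin n × Fin n)
    (t : MvPolynomial (GraphVars n) ℂ) :
    MvPolynomial.coeff (Finsupp.single (Sum.inr q : GraphVars n) 1)
        (MvPolynomial.bind₁ (shift x) t) =
      MvPolynomial.eval x (MvPolynomial.pderiv (Sum.inr q) t) := by
  have h1 : MvPolynomial.coeff (Finsupp.single (Sum.inr q : GraphVars n) 1)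
      (MvPolynomial.bind₁ (shift x) t) =
      MvPolynomial.eval 0 (MvPolynomial.pderiv (Sum.inr q) (MvPolynomial.bind₁ (shift x) t)) := by
    simp only [MvPolynomial.eval_zero, MvPolynomial.constantCoeff_eq, MvPolynomial.coeff_pderiv,
      Finsupp.coe_zero, Pi.zero_apply, zero_add, Nat.cast_zero, mul_one]
  rw [h1, pderiv_inr_bind₁_shift, eval_bind₁_shift, shiftPoint_zero]

/-- The linear `C`-coefficient matrix of the shifted tests is the `C`-Jacobian at `x`. -/
theorem linCoeffC_bind₁_shift (E : EqSystem n) (x : GraphVars n → ℂ) :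
    (linCoeffC fun o => MvPolynomial.bind₁ (shift x) (E.testPoly (E.tests.get o))) =
      E.jacobianC x := by
  ext o q
  simp only [linCoeffC, EqSystem.jacobianC, Matrix.of_apply, coeff_inr_bind₁_shift]

end Shift

/-! ## `H_red♭` (cost version) and `H_red` from `CoeffIdentity` -/

/-- **`CoeffIdentity → H_red♭` (cost version, reduced at ANY point of the graph).** -/
theorem costRankCost_of_coeffIdentity (hC : CoeffIdentity) : ReducedSystemsCostRankCost := by
  intro n E hE hred
  obtain ⟨x, hx, hJ⟩ := hred
  obtain ⟨gs, hns, hlen, hmem⟩ := exists_isNonscalarSeq_tests E hE.1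
  -- substitute the affine-linear forms `θ_x`: free (BCS §4.1 Rem. (4.3))
  obtain ⟨hns', hmem'⟩ :=
    IsNonscalarSeq.aeval_append (θ := shift x) (hs := []) (shift_mem_freeSpan x)
      isNonscalarSeq_nil hns
  refine tensorRank_le_of_vanishing hC
    (fun o => MvPolynomial.bind₁ (shift x) (E.testPoly (E.tests.get o)))
    (fun o y hy => eval_bind₁_shift_eq_zero hx
      (fun z hz => hE.eval_testPoly_eq_zero hz (List.get_mem _ _)) hy)
    ⟨gs.map (MvPolynomial.aeval (shift x)) ++ [], hns', by simpa using hlen, fun o => ?_⟩ ?_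
  · rw [← MvPolynomial.aeval_eq_bind₁]
    exact hmem' _ (hmem o)
  · rw [linCoeffC_bind₁_shift]; exact hJ

/-- **`CoeffIdentity → H_red`.** The reduced branch of the split hinges on ONE named, classical
statement. -/
theorem reducedForce_of_coeffIdentity (hC : CoeffIdentity) :
    ReducedEquationsForceMultiplication :=
  reducedForce_of_costRankCost (costRankCost_of_coeffIdentity hC)

/-- `CoeffIdentity → H_mult → H`. -/
theorem forceMultiplication_of_coeffIdentity (hC : CoeffIdentity) (hmult : MultiplicityReduction) :
    EquationsForceMultiplication :=
  forceMultiplication_of_split (reducedForce_of_coeffIdentity hC) hmult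

/-- **The route modulo its two open pieces and one classical identity:**
`V → CoeffIdentity → H_mult → S`. -/
theorem matrixMultiplication_of_coeffIdentity (hV : GraphEquationsQuadratic) (hC : CoeffIdentity)
    (hmult : MultiplicityReduction) : _root_.MatrixMultiplication :=
  closes hV (forceMultiplication_of_coeffIdentity hC hmult)

end Summit.MatrixMultiplication.MatrixMultiplication.Theorems.GraphEquations

end
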